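import Mathlib
import HarnessLib
import Summits.ValiantsHypothesis.ValiantsHypothesis.Theorems.MonotoneRestorationOrbitRestorationQPSmlLowRankNarrow
import Summits.ValiantsHypothesis.ValiantsHypothesis.Theorems.MonotoneRestorationOrbitRestorationQPSmlAffineFlattening

/-!
# Small AFFINE column-set-multilinear `ΣΠΣ` circuits force narrow power-sum support of every homogeneous component
(crux `OrbitRestorationQP`, stmt-ValiantsHypothesis-18293 — lane SML of stub A_∞ `stub_sigmaPiSigmaValue`, extension to
depth-three circuits WITH CONSTANTS)

The matrix-side lower-bound half of the set-multilinear stratum (`SmlColNarrow.narrow_of_colSml_lt_choose`) assumed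
column-LINEAR gates, so that `p = rename Prod.fst f` is homogeneous of degree `n`.  With AFFINE gates
`A_{t,b} = β_{t,b} + Σ_a α_{t,b,a} x_{(a,b)}` the symmetric shadow `p = Σ_t Π_b (β_{t,b} + Σ_a α_{t,b,a} y_a)` has components in
every degree `e ≤ n`.  Partial derivatives commute with taking homogeneous components (`pderivFold_homogeneousComponent`), so
the `j`-th flattening space of the component `p_e` is the image of that of `p` under the linear projection `Hom_{e-j}`; by the
affine flattening bound (`SmlAffineFlattening.derivs_rename_fst_mem_span_affine`) it is spanned by `≤ s` polynomials.  Hence: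

* `narrow_component_of_affineColSml_lt_choose` — **if `f = Σ_{t<s} Π_{b<n} (β_{t,b} + Σ_a α_{t,b,a} x_{(a,b)})` is ROW- and
  COLUMN-symmetric, `2j ≤ n` and `s < C(n-j, j)`, then EVERY homogeneous component `Hom_e (rename fst f)` is a `ℂ`-combination
  of power-sum products `Π_{k∈μ} p_k` with `μ.sum = e` and FEWER THAN `j` parts `≥ 2`;**
* `narrow_of_affineColSml_lt_choose` — consequently `rename fst f` itself is a `ℂ`-combination of power-sum products `p_μ`
  with `μ.sum ≤ n` and fewer than `j` parts `≥ 2`.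

Contrapositive (the LOWER BOUND, now for genuine depth-three circuits with constants): if some homogeneous component of the
symmetric shadow involves a partition with `≥ j` parts `≥ 2`, every column-symmetric affine column-sml `ΣΠΣ` expression of
`f` has at least `C(n-j, j)` product gates.  What remains for the affine STRATUM (restoration) is the normal-form extraction
(`β`-grid interpolation of `Σ_g Π_b (β + C_b + Σ_i τ_i x_{(g i,b)})` and injectivity of `x_{ab} ↦ y_a` on column-symmetric
column-multilinear expressions of every degree).  Honest label: helper theorems for a stratum of the off-path sub-rung A_∞;
no stub closed; VP ≠ VNP untouched. [folklore]
-/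

set_option linter.dupNamespace false

namespace Summit.ValiantsHypothesis.ValiantsHypothesis.Theorems.SmlAffineNarrow

open MvPolynomial SmlDeltaCalculus SmlChainRule SmlFlattening SmlLowRankNarrow SmlAffineFlattening

/-! ### Partial derivatives commute with homogeneous components -/

/-- `∂_x Hom_j f = Hom_{j-1} (∂_x f)` for `j ≥ 1` (any index type). [folklore] -/
theorem pderiv_homogeneousComponent {σ : Type*} (x : σ) {j : ℕ} (hj : 1 ≤ j) (f : MvPolynomial σ ℂ) :
    pderiv x (homogeneousComponent j f) = homogeneousComponent (j - 1) (pderiv x f) := by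
  classical
  ext m
  simp only [coeff_pderiv, coeff_homogeneousComponent]
  have hdeg : (m + Finsupp.single x 1).degree = m.degree + 1 := by
    rw [map_add, Finsupp.degree_single]
  by_cases h : m.degree = j - 1
  · rw [if_pos h, if_pos (by rw [hdeg]; omega)]
  · rw [if_neg h, if_neg (by rw [hdeg]; omega), zero_mul]

/-- **Iterated partials commute with homogeneous components**: `∂_ρ (Hom_e f) = Hom_{e-j} (∂_ρ f)` for a `j`-tuple `ρ` with
`j ≤ e`, and `∂_ρ (Hom_e f) = 0` if `j > e` (both folds written def-free as `List.foldl` over `List.finRange j`). [folklore] -/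
theorem pderivFold_homogeneousComponent {σ : Type*} :
    ∀ (j : ℕ) (ρ : Fin j → σ) (e : ℕ) (f : MvPolynomial σ ℂ),
      List.foldl (fun (q : MvPolynomial σ ℂ) i => pderiv (ρ i) q) (homogeneousComponent e f) (List.finRange j) =
        if j ≤ e then
          homogeneousComponent (e - j) (List.foldl (fun (q : MvPolynomial σ ℂ) i => pderiv (ρ i) q) f (List.finRange j))
        else 0 := by
  intro j
  induction j with
  | zero => intro ρ e f; simp
  | succ j ih =>
    intro ρ e f
    simp only [List.finRange_succ, List.foldl_cons, List.foldl_map]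
    rcases Nat.eq_zero_or_pos e with rfl | he
    · rw [homogeneousComponent_zero, pderiv_C, if_neg (by omega)]
      exact pderivFoldList_zero (fun i : Fin j => ρ i.succ) (List.finRange j)
    · rw [pderiv_homogeneousComponent _ he, ih (fun i => ρ i.succ) (e - 1) (pderiv (ρ 0) f)]
      by_cases hj : j + 1 ≤ e
      · rw [if_pos (by omega), if_pos hj, show e - 1 - j = e - (j + 1) by omega]
      · rw [if_neg (by omega), if_neg hj]

/-- Homogeneous components of a symmetric polynomial are symmetric. [folklore] -/
theorem isSymmetric_homogeneousComponent {σ : Type*} {p : MvPolynomial σ ℂ} (hs : p.IsSymmetric) (e : ℕ) :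
    (homogeneousComponent e p).IsSymmetric := by
  intro g
  rw [rename_homogeneousComponent, hs g]

/-- **Flattening spaces of components are projections of flattening spaces**: if all `j`-th iterated partials of `p` lie in
`span w`, then all `j`-th iterated partials of `Hom_e p` lie in `span (Hom_{e-j} '' w)`. [folklore] -/
theorem derivs_homogeneousComponent_mem_span {σ : Type*} [DecidableEq (MvPolynomial σ ℂ)] {j : ℕ} (p : MvPolynomial σ ℂ)
    (w : Finset (MvPolynomial σ ℂ))
    (hw : ∀ ρ : Fin j → σ, List.foldl (fun (q : MvPolynomial σ ℂ) i => pderiv (ρ i) q) p (List.finRange j) ∈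
      Submodule.span ℂ (w : Set (MvPolynomial σ ℂ)))
    (e : ℕ) (ρ : Fin j → σ) :
    List.foldl (fun (q : MvPolynomial σ ℂ) i => pderiv (ρ i) q) (homogeneousComponent e p) (List.finRange j) ∈
      Submodule.span ℂ ((w.image (homogeneousComponent (e - j) : MvPolynomial σ ℂ → MvPolynomial σ ℂ)) :
        Set (MvPolynomial σ ℂ)) := by
  rw [pderivFold_homogeneousComponent]
  split_ifs with h
  · rw [Finset.coe_image, Submodule.span_image]
    exact Submodule.mem_map_of_mem (hw ρ)
  · exact Submodule.zero_mem _

/-! ### Degree of an affine column-set-multilinear expression -/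

/-- An affine column form has total degree `≤ 1`. [folklore] -/
theorem totalDegree_affineForm_le {n : ℕ} (γ : ℂ) (β : Fin n → ℂ) (b : Fin n) :
    (C γ + ∑ a : Fin n, C (β a) * X (a, b) : MvPolynomial (Fin n × Fin n) ℂ).totalDegree ≤ 1 := by
  refine (totalDegree_add _ _).trans (max_le ?_ ?_)
  · rw [totalDegree_C]; exact Nat.zero_le _
  · refine totalDegree_finsetSum_le fun a _ => (totalDegree_mul _ _).trans ?_
    rw [totalDegree_C, totalDegree_X]

/-- The symmetric shadow `rename fst (Σ_t Π_b A_{t,b})` of an affine column-sml expression has total degree `≤ n`. [folklore] -/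
theorem totalDegree_rename_fst_affineColSml_le {n s : ℕ} (β : Fin s → Fin n → ℂ) (α : Fin s → Fin n → Fin n → ℂ) :
    (rename (Prod.fst : Fin n × Fin n → Fin n)
      (∑ t : Fin s, ∏ b : Fin n, (C (β t b) + ∑ a : Fin n, C (α t b a) * X (a, b)) :
        MvPolynomial (Fin n × Fin n) ℂ)).totalDegree ≤ n := by
  refine (totalDegree_rename_le _ _).trans (totalDegree_finsetSum_le fun t _ => ?_)
  refine (totalDegree_finsetProd _ _).trans ?_
  calc ∑ b : Fin n, (C (β t b) + ∑ a : Fin n, C (α t b a) * X (a, b) : MvPolynomial (Fin n × Fin n) ℂ).totalDegree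
      ≤ ∑ _b : Fin n, 1 := Finset.sum_le_sum fun b _ => totalDegree_affineForm_le _ _ _
    _ = n := by simp

/-! ### Narrowness of every homogeneous component -/

/-- **Small affine column-sml circuits force narrow power-sum support of EVERY HOMOGENEOUS COMPONENT.** [folklore] -/
theorem narrow_component_of_affineColSml_lt_choose {n s j : ℕ} (h2j : 2 * j ≤ n) (β : Fin s → Fin n → ℂ)
    (α : Fin s → Fin n → Fin n → ℂ)
    (hrow : ∀ σ : Equiv.Perm (Fin n), rename (fun v : Fin n × Fin n => (σ v.1, v.2))
      (∑ t : Fin s, ∏ b : Fin n, (C (β t b) + ∑ a : Fin n, C (α t b a) * X (a, b)) : MvPolynomial (Fin n × Fin n) ℂ) =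
      ∑ t : Fin s, ∏ b : Fin n, (C (β t b) + ∑ a : Fin n, C (α t b a) * X (a, b)))
    (hcol : ∀ τ : Equiv.Perm (Fin n), rename (fun v : Fin n × Fin n => (v.1, τ v.2))
      (∑ t : Fin s, ∏ b : Fin n, (C (β t b) + ∑ a : Fin n, C (α t b a) * X (a, b)) : MvPolynomial (Fin n × Fin n) ℂ) =
      ∑ t : Fin s, ∏ b : Fin n, (C (β t b) + ∑ a : Fin n, C (α t b a) * X (a, b)))
    (hs : s < Nat.choose (n - j) j) (e : ℕ) :
    ∃ (S : Finset (Multiset ℕ)) (c : Multiset ℕ → ℂ),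
      (∀ μ ∈ S, (∀ k ∈ μ, 0 < k) ∧ μ.sum = e ∧ (μ.filter fun k => 2 ≤ k).card < j) ∧
      homogeneousComponent e (rename (Prod.fst : Fin n × Fin n → Fin n)
        (∑ t : Fin s, ∏ b : Fin n, (C (β t b) + ∑ a : Fin n, C (α t b a) * X (a, b)))) =
        ∑ μ ∈ S, c μ • (μ.map (psum (Fin n) ℂ)).prod := by
  classical
  set p := rename (Prod.fst : Fin n × Fin n → Fin n)
    (∑ t : Fin s, ∏ b : Fin n, (C (β t b) + ∑ a : Fin n, C (α t b a) * X (a, b)) : MvPolynomial (Fin n × Fin n) ℂ)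
    with hp
  by_cases hen : e ≤ n
  · have hsymm : (homogeneousComponent e p).IsSymmetric :=
      isSymmetric_homogeneousComponent (isSymmetric_rename_fst _ hrow) e
    have hhom : (homogeneousComponent e p).IsHomogeneous e := homogeneousComponent_isHomogeneous e p
    have hjn : j ≤ n := by omega
    -- the flattening finset of `p` and its projection
    let w : Finset (MvPolynomial (Fin n) ℂ) := Finset.univ.image fun t : Fin s =>
      rename (Prod.fst : Fin n × Fin n → Fin n)
        (∏ b ∈ Finset.univ \ Finset.univ.image (fun i : Fin j => (⟨(i : ℕ), by omega⟩ : Fin n)),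
          (C (β t b) + ∑ a : Fin n, C (α t b a) * X (a, b)))
    have hw : ∀ ρ : Fin j → Fin n, List.foldl (fun (q : MvPolynomial (Fin n) ℂ) i => pderiv (ρ i) q) p
        (List.finRange j) ∈ Submodule.span ℂ (w : Set (MvPolynomial (Fin n) ℂ)) := fun ρ => by
      rw [hp]; exact derivs_rename_fst_mem_span_affine hjn β α hcol ρ
    refine narrow_of_derivs_in_small_span hen h2j _ hsymm hhom
      (w.image (homogeneousComponent (e - j) : MvPolynomial (Fin n) ℂ → MvPolynomial (Fin n) ℂ))
      (fun ρ => derivs_homogeneousComponent_mem_span p w hw e ρ) ?_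
    calc (w.image (homogeneousComponent (e - j) : MvPolynomial (Fin n) ℂ → MvPolynomial (Fin n) ℂ)).card
        ≤ w.card := Finset.card_image_le
      _ ≤ (Finset.univ : Finset (Fin s)).card := Finset.card_image_le
      _ = s := by simp
      _ < Nat.choose (n - j) j := hs
  · -- above the degree: the component vanishes
    refine ⟨∅, fun _ => 0, fun μ hμ => absurd hμ (Finset.notMem_empty μ), ?_⟩
    rw [Finset.sum_empty]
    exact homogeneousComponent_eq_zero _ _
      (lt_of_le_of_lt (totalDegree_rename_fst_affineColSml_le β α) (by omega))

/-- **Small affine column-sml circuits force narrow power-sum support** (all components at once): `rename fst f` is a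
`ℂ`-combination of power-sum products `p_μ` with `μ.sum ≤ n` and fewer than `j` parts `≥ 2`. [folklore] -/
theorem narrow_of_affineColSml_lt_choose {n s j : ℕ} (h2j : 2 * j ≤ n) (β : Fin s → Fin n → ℂ)
    (α : Fin s → Fin n → Fin n → ℂ)
    (hrow : ∀ σ : Equiv.Perm (Fin n), rename (fun v : Fin n × Fin n => (σ v.1, v.2))
      (∑ t : Fin s, ∏ b : Fin n, (C (β t b) + ∑ a : Fin n, C (α t b a) * X (a, b)) : MvPolynomial (Fin n × Fin n) ℂ) =
      ∑ t : Fin s, ∏ b : Fin n, (C (β t b) + ∑ a : Fin n, C (α t b a) * X (a, b)))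
    (hcol : ∀ τ : Equiv.Perm (Fin n), rename (fun v : Fin n × Fin n => (v.1, τ v.2))
      (∑ t : Fin s, ∏ b : Fin n, (C (β t b) + ∑ a : Fin n, C (α t b a) * X (a, b)) : MvPolynomial (Fin n × Fin n) ℂ) =
      ∑ t : Fin s, ∏ b : Fin n, (C (β t b) + ∑ a : Fin n, C (α t b a) * X (a, b)))
    (hs : s < Nat.choose (n - j) j) :
    ∃ (S : Finset (Multiset ℕ)) (c : Multiset ℕ → ℂ),
      (∀ μ ∈ S, (∀ k ∈ μ, 0 < k) ∧ μ.sum ≤ n ∧ (μ.filter fun k => 2 ≤ k).card < j) ∧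
      rename (Prod.fst : Fin n × Fin n → Fin n)
        (∑ t : Fin s, ∏ b : Fin n, (C (β t b) + ∑ a : Fin n, C (α t b a) * X (a, b))) =
        ∑ μ ∈ S, c μ • (μ.map (psum (Fin n) ℂ)).prod := by
  classical
  set p := rename (Prod.fst : Fin n × Fin n → Fin n)
    (∑ t : Fin s, ∏ b : Fin n, (C (β t b) + ∑ a : Fin n, C (α t b a) * X (a, b)) : MvPolynomial (Fin n × Fin n) ℂ)
    with hp
  -- componentwise data
  have hcomp : ∀ e : ℕ, ∃ (S : Finset (Multiset ℕ)) (c : Multiset ℕ → ℂ),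
      (∀ μ ∈ S, (∀ k ∈ μ, 0 < k) ∧ μ.sum = e ∧ (μ.filter fun k => 2 ≤ k).card < j) ∧
      homogeneousComponent e p = ∑ μ ∈ S, c μ • (μ.map (psum (Fin n) ℂ)).prod := fun e => by
    rw [hp]; exact narrow_component_of_affineColSml_lt_choose h2j β α hrow hcol hs e
  choose S c hS hpS using hcomp
  have hdeg : p.totalDegree ≤ n := by rw [hp]; exact totalDegree_rename_fst_affineColSml_le β α
  -- the pieces `S e`, `e ≤ deg p`, are pairwise disjoint (the degree `μ.sum = e` separates them)
  have hdisj : ((Finset.range (p.totalDegree + 1) : Finset ℕ) : Set ℕ).PairwiseDisjoint S := by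
    intro e _ e' _ hne
    refine Finset.disjoint_left.2 fun μ hμ hμ' => hne ?_
    rw [← (hS e μ hμ).2.1, ← (hS e' μ hμ').2.1]
  refine ⟨(Finset.range (p.totalDegree + 1)).biUnion S, fun μ => c μ.sum μ, fun μ hμ => ?_, ?_⟩
  · obtain ⟨e, he, hμ⟩ := Finset.mem_biUnion.1 hμ
    obtain ⟨hpos, hsum, hnar⟩ := hS e μ hμ
    exact ⟨hpos, by rw [hsum]; exact (Nat.lt_succ_iff.1 (Finset.mem_range.1 he)).trans hdeg, hnar⟩
  · rw [Finset.sum_biUnion hdisj]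
    conv_lhs => rw [← sum_homogeneousComponent p]
    refine Finset.sum_congr rfl fun e _ => ?_
    rw [hpS e]
    refine Finset.sum_congr rfl fun μ hμ => ?_
    dsimp only
    rw [(hS e μ hμ).2.1]

end Summit.ValiantsHypothesis.ValiantsHypothesis.Theorems.SmlAffineNarrow
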